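import Mathlib

/-!
# `SeaFactorisationBridge` (crux stmt-QuantumFields-13880) — negative-side support: phase-quenched
# rarity is not transported to the reference sea (finite models of the stub-4 obstruction)

Wave-5 audit of stub 4 `stub_complementCoercive` (skeleton r12) of the line `proper-time-quarantine`.
The hinge `CoerciveAt` states its laws (separator Wegner law, windowed dilution, pin) under the
PHASE-QUENCHED law `P_pq = μ_ref · e^{−ΣW} / ⟨e^{−ΣW}⟩_ref`, `ΣW ≥ 0` the (extensive) edge functional,
while the conclusion `EdgeQuarantinedCond` is a PRODUCT law under the reference sea `μ_ref` itself:
`⟨∏ᵢ 1_{bad Bᵢ}⟩_ref ≤ (C t^α + ε)ⁿ` for `K'`-separated families of `n` mesoscopic boxes.  Reweighting by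
`e^{−W}`, `W ≥ 0`, transports rarity in ONE direction only.  Definition-free finite models:

* `tilted_mass_le`, `mass_le_exp_mul_tilted` — the two model-free inequalities between a reference
  law `r` and its tilt `r e^{−W}`: `Z·P_pq(E) ≤ μ_ref(E) ≤ e^{sup_E W} · Z·P_pq(E)`.  Rarity passes from
  `μ_ref` to `P_pq` at cost `1/Z`; the way back costs `e^{sup_E W}`, largest exactly on the bad
  (resonant) events where `W` is large.
* `twoPoint_witness` — two-point space {good, bad}: `μ_ref(bad) = 1 − δ'`, `W(bad) = w`, `W(good) = 0`;
  for every `δ, δ' ∈ (0,1)` some `w ≥ 0` gives `P_pq(bad) ≤ δ` — and the factor `e^{sup_E W}` of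
  `mass_le_exp_mul_tilted` is attained.  A `P_pq`-law of any strength on the bad event says nothing
  about its `μ_ref`-probability.
* `sum_pattern_prod`, `productBoxes_*` — `n` independent boxes (patterns `Fin n → Bool`), reference law
  `∏ᵢ (bad ↦ 1−δ', good ↦ δ')`, EXTENSIVE edge functional `W = w · #{bad boxes}`:
  `⟨e^{−W}⟩_ref = ((1−δ')e^{−w} + δ')ⁿ` (exponentially small), `P_pq(all n bad) = pⁿ` with
  `p = (1−δ')e^{−w}/((1−δ')e^{−w}+δ') ≤ δ` — product rarity under `P_pq` in its strongest form — yet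
  `μ_ref(all n bad) = (1−δ')ⁿ`.
* `quenched_product_rarity_not_transported` — hence for every `δ ∈ (0,1)` and every target `θ < 1`
  there is such a model with `P_pq(all n bad) ≤ δⁿ` for all `n` but `μ_ref(all n bad) ≥ θⁿ` (`> θⁿ` is
  not even needed: `θ` may be taken as close to `1` as desired while `δ → 0`).  So no clause of the
  form "bad boxes are (product-)rare under `P_pq`" implies a clause "bad boxes are product-rare under
  `μ_ref`" without an input bounding `e^{ΣW}` ON the bad events — a law under `μ_ref`, which is what
  the r12 typing of stub 4 records as new content (L1–L4 + bad-5).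
-/

namespace Summit.QuantumFields.QCD.Theorems.SeaFactorisationBridge.Negative

open Finset Real

/-! ## §1 The two model-free transport inequalities -/

/-- **Quenching only loses mass**: for a reference law `r ≥ 0` tilted by `e^{−W}`, `W ≥ 0`, every event
has `Σ_E r e^{−W} ≤ Σ_E r`, i.e. `Z · P_pq(E) ≤ μ_ref(E)` — rarity under `μ_ref` passes to `P_pq` at the
cost `1/Z` only. [folklore] -/
theorem tilted_mass_le {ι : Type*} (E : Finset ι) (r W : ι → ℝ) (hr : ∀ i, 0 ≤ r i)
    (hW : ∀ i, 0 ≤ W i) : ∑ i ∈ E, r i * exp (-W i) ≤ ∑ i ∈ E, r i := by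
  refine sum_le_sum fun i _ => ?_
  have h1 : exp (-W i) ≤ 1 := exp_le_one_iff.2 (by linarith [hW i])
  exact mul_le_of_le_one_right (hr i) h1

/-- **The way back costs `e^{sup_E W}`**: if `W ≤ B` on `E` then `Σ_E r ≤ e^{B} Σ_E r e^{−W}`, i.e.
`μ_ref(E) ≤ e^{sup_E W} · Z · P_pq(E)` — the only model-free bound of a reference probability by a
phase-quenched one, and its constant is attained (`twoPoint_witness`). [folklore] -/
theorem mass_le_exp_mul_tilted {ι : Type*} (E : Finset ι) (r W : ι → ℝ) (B : ℝ) (hr : ∀ i, 0 ≤ r i)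
    (hB : ∀ i ∈ E, W i ≤ B) : ∑ i ∈ E, r i ≤ exp B * ∑ i ∈ E, r i * exp (-W i) := by
  rw [mul_sum]
  refine sum_le_sum fun i hi => ?_
  have h1 : 1 ≤ exp B * exp (-W i) := by
    rw [← exp_add]
    exact one_le_exp (by linarith [hB i hi])
  calc r i = r i * 1 := (mul_one _).symm
    _ ≤ r i * (exp B * exp (-W i)) := mul_le_mul_of_nonneg_left h1 (hr i)
    _ = exp B * (r i * exp (-W i)) := by ring

/-! ## §2 The two-point witness -/

/-- For every `c > 0` there is `w ≥ 0` with `e^{−w} < c` (namely `w = 1/c`). [folklore] -/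
theorem exists_exp_neg_lt (c : ℝ) (hc : 0 < c) : ∃ w : ℝ, 0 ≤ w ∧ exp (-w) < c := by
  refine ⟨1 / c, (one_div_pos.2 hc).le, ?_⟩
  have h1 : 1 / c < exp (1 / c) := by linarith [add_one_le_exp (1 / c)]
  rw [exp_neg, inv_lt_comm₀ (exp_pos _) hc]
  rwa [inv_eq_one_div]

/-- **Phase-quenched probability of the bad point** of the two-point model (reference law
`bad ↦ 1 − δ'`, `good ↦ δ'`; edge functional `W(bad) = w`, `W(good) = 0`):
`P_pq(bad) = (1−δ')e^{−w}/((1−δ')e^{−w} + δ') ≤ (1−δ')e^{−w}/δ'`. [folklore] -/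
theorem twoPoint_quenched_bad_le (δ' w : ℝ) (hδ' : 0 < δ') (hδ'1 : δ' ≤ 1) :
    (1 - δ') * exp (-w) / ((1 - δ') * exp (-w) + δ') ≤ (1 - δ') * exp (-w) / δ' := by
  have hnum : 0 ≤ (1 - δ') * exp (-w) := mul_nonneg (by linarith) (exp_pos _).le
  exact div_le_div_of_nonneg_left hnum hδ' (by linarith)

/-- **Two-point witness: a phase-quenched law of any strength on the bad event does not bound its
reference probability.**  For every `δ, δ' ∈ (0,1)` there is `w ≥ 0` such that, on `{good, bad}`
(`Bool`, `bad = true`) with reference law `r = (bad ↦ 1−δ', good ↦ δ')` (a probability law) and edge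
functional `W = (bad ↦ w, good ↦ 0) ≥ 0`: `μ_ref(bad) = 1 − δ'` while
`P_pq(bad) = r(bad)e^{−W(bad)}/⟨e^{−W}⟩_ref ≤ δ`; and the transport constant of
`mass_le_exp_mul_tilted` is attained, `μ_ref(bad) = e^{W(bad)} · r(bad)e^{−W(bad)}`. [folklore] -/
theorem twoPoint_witness (δ δ' : ℝ) (hδ : 0 < δ) (hδ' : 0 < δ') (hδ'1 : δ' < 1) :
    ∃ w : ℝ, 0 ≤ w ∧
      let r : Bool → ℝ := fun b => if b then 1 - δ' else δ'
      let W : Bool → ℝ := fun b => if b then w else 0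
      (∀ b, 0 ≤ r b) ∧ ∑ b, r b = 1 ∧ (∀ b, 0 ≤ W b) ∧
      r true = 1 - δ' ∧
      r true * exp (-W true) / ∑ b, r b * exp (-W b) ≤ δ ∧
      r true = exp (W true) * (r true * exp (-W true)) := by
  obtain ⟨w, hw0, hw⟩ := exists_exp_neg_lt (δ * δ' / (1 - δ')) (by
    have : 0 < 1 - δ' := by linarith
    positivity)
  refine ⟨w, hw0, ?_⟩
  intro r W
  have hr : ∀ b, 0 ≤ r b := fun b => by cases b <;> simp [r] <;> linarith
  have hW : ∀ b, 0 ≤ W b := fun b => by cases b <;> simp [W, hw0]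
  refine ⟨hr, ?_, hW, by simp [r], ?_, ?_⟩
  · simp [r]
  · have hsum : ∑ b, r b * exp (-W b) = (1 - δ') * exp (-w) + δ' := by
      simp [r, W]
    rw [hsum]
    simp only [r, W, if_true]
    refine (twoPoint_quenched_bad_le δ' w hδ' hδ'1.le).trans ?_
    have h1 : 0 < 1 - δ' := by linarith
    rw [div_le_iff₀ hδ']
    have h2 : (1 - δ') * exp (-w) ≤ (1 - δ') * (δ * δ' / (1 - δ')) :=
      mul_le_mul_of_nonneg_left hw.le h1.le
    calc (1 - δ') * exp (-w) ≤ (1 - δ') * (δ * δ' / (1 - δ')) := h2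
      _ = δ * δ' := by field_simp
  · simp only [r, W, if_true]
    rw [← mul_assoc, mul_comm (exp w), mul_assoc, ← exp_add]
    simp

/-! ## §3 Independent boxes: product rarity under `P_pq` versus product rarity under `μ_ref` -/

/-- Sum over bad/good patterns of `n` boxes of a product weight: `Σ_x ∏ᵢ g(xᵢ) = (g bad + g good)ⁿ`. [folklore] -/
theorem sum_pattern_prod (n : ℕ) (g : Bool → ℝ) :
    ∑ x : Fin n → Bool, ∏ i, g (x i) = (g true + g false) ^ n := by
  classical
  have key := Finset.prod_univ_sum (fun _ : Fin n => (univ : Finset Bool)) (fun _ b => g b)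
  rw [Fintype.piFinset_univ] at key
  rw [← key]
  simp

/-- **The reference product law is a probability law**: `Σ_x ∏ᵢ (bad ↦ 1−δ', good ↦ δ')(xᵢ) = 1`. [folklore] -/
theorem productBoxes_ref_total (n : ℕ) (δ' : ℝ) :
    ∑ x : Fin n → Bool, ∏ i, (if x i then 1 - δ' else δ') = 1 := by
  have h := sum_pattern_prod n (fun b => if b then 1 - δ' else δ')
  simp only [if_true] at h
  rw [h]
  simp

/-- **The tilt factorises**: with the EXTENSIVE edge functional `W(x) = Σᵢ (bad ↦ w, good ↦ 0)(xᵢ)`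
(`= w · #{bad boxes}`), `r(x) e^{−W(x)} = ∏ᵢ (bad ↦ (1−δ')e^{−w}, good ↦ δ')(xᵢ)`. [folklore] -/
theorem productBoxes_tilt_factorises (n : ℕ) (δ' w : ℝ) (x : Fin n → Bool) :
    (∏ i, (if x i then 1 - δ' else δ')) * exp (-∑ i, (if x i then w else 0)) =
      ∏ i, (if x i then (1 - δ') * exp (-w) else δ') := by
  rw [← sum_neg_distrib, exp_sum, ← prod_mul_distrib]
  refine prod_congr rfl fun i _ => ?_
  cases x i <;> simp

/-- **The edge functional is non-negative and extensive**: `0 ≤ W(x)` and `W(all bad) = n·w`. [folklore] -/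
theorem productBoxes_W_nonneg_extensive (n : ℕ) (w : ℝ) (hw : 0 ≤ w) :
    (∀ x : Fin n → Bool, 0 ≤ ∑ i, (if x i then w else 0)) ∧
      ∑ _i : Fin n, (if (fun _ : Fin n => true) _i then w else 0) = n * w := by
  refine ⟨fun x => sum_nonneg fun i _ => ?_, by simp⟩
  split_ifs <;> simp [hw]

/-- **Partition function of the tilt** (`= ⟨e^{−W}⟩_ref`, the reference law being normalised):
`Σ_x r(x)e^{−W(x)} = ((1−δ')e^{−w} + δ')ⁿ` — exponentially small in the number of boxes as soon as
`(1−δ')e^{−w} + δ' < 1`, the finite shadow of "`ΣW` is extensive". [folklore] -/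
theorem productBoxes_partition (n : ℕ) (δ' w : ℝ) :
    ∑ x : Fin n → Bool, (∏ i, (if x i then 1 - δ' else δ')) * exp (-∑ i, (if x i then w else 0)) =
      ((1 - δ') * exp (-w) + δ') ^ n := by
  simp_rw [productBoxes_tilt_factorises]
  have h := sum_pattern_prod n (fun b => if b then (1 - δ') * exp (-w) else δ')
  simp only [if_true] at h
  rw [h]
  simp

/-- **Reference probability that every box of the family is bad**: `μ_ref(all n bad) = (1−δ')ⁿ`. [folklore] -/
theorem productBoxes_ref_allBad (n : ℕ) (δ' : ℝ) :
    ∑ x : Fin n → Bool, (if x = fun _ => true then ∏ i, (if x i then 1 - δ' else δ') else 0) =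
      (1 - δ') ^ n := by
  rw [Finset.sum_ite_eq' univ (fun _ : Fin n => true)]
  simp

/-- **Phase-quenched probability that every box of the family is bad**: `P_pq(all n bad) = pⁿ`,
`p = (1−δ')e^{−w}/((1−δ')e^{−w} + δ')` — independent boxes stay independent under the product tilt,
so the model satisfies product rarity under `P_pq` in its strongest (all orders, exact) form. [folklore] -/
theorem productBoxes_quenched_allBad (n : ℕ) (δ' w : ℝ) :
    (∑ x : Fin n → Bool, (if x = fun _ => true then
        (∏ i, (if x i then 1 - δ' else δ')) * exp (-∑ i, (if x i then w else 0)) else 0)) /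
      (∑ x : Fin n → Bool, (∏ i, (if x i then 1 - δ' else δ')) * exp (-∑ i, (if x i then w else 0))) =
      ((1 - δ') * exp (-w) / ((1 - δ') * exp (-w) + δ')) ^ n := by
  rw [productBoxes_partition, Finset.sum_ite_eq' univ (fun _ : Fin n => true), if_pos (mem_univ _),
    productBoxes_tilt_factorises]
  simp only [if_true, prod_const, card_univ, Fintype.card_fin]
  rw [div_pow]

/-- **Phase-quenched product rarity is not transported to the reference sea.**  For every `δ ∈ (0,1)`
(per-box rarity under `P_pq`, as small as desired) and every `θ ∈ [0,1)` (target per-box bound under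
`μ_ref`, e.g. `C t^α + ε`, as close to `1` as desired) there are `δ' ∈ (0,1)` and `w ≥ 0` such that in
the independent-box model (reference law `∏ᵢ(bad ↦ 1−δ', good ↦ δ')`, extensive edge functional
`W = w·#{bad}`): for EVERY `n`, `P_pq(all n bad) ≤ δⁿ` while `θⁿ ≤ (1−δ')ⁿ = μ_ref(all n bad)`.
So "bad boxes are product-rare under the phase-quenched law" (the form of every clause of the hinge
`CoerciveAt`) does not imply "bad boxes are product-rare under `μ_ref`" (`EdgeQuarantinedCond`)
without an input on `e^{ΣW}` restricted to the bad events, i.e. a law under `μ_ref`. [folklore] -/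
theorem quenched_product_rarity_not_transported (δ θ : ℝ) (hδ : 0 < δ) (hθ0 : 0 ≤ θ) (hθ1 : θ < 1) :
    ∃ δ' w : ℝ, 0 < δ' ∧ δ' < 1 ∧ 0 ≤ w ∧ ∀ n : ℕ,
      (∑ x : Fin n → Bool, (if x = fun _ => true then
          (∏ i, (if x i then 1 - δ' else δ')) * exp (-∑ i, (if x i then w else 0)) else 0)) /
        (∑ x : Fin n → Bool, (∏ i, (if x i then 1 - δ' else δ')) * exp (-∑ i, (if x i then w else 0)))
        ≤ δ ^ n ∧
      θ ^ n ≤ ∑ x : Fin n → Bool, (if x = fun _ => true then ∏ i, (if x i then 1 - δ' else δ') else 0) := by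
  -- reference badness `1 − δ'` at least `θ` (and at least `1/2`)
  set δ' : ℝ := min (1 / 2) (1 - θ) with hδ'def
  have hδ'0 : 0 < δ' := lt_min (by norm_num) (by linarith)
  have hδ'1 : δ' < 1 := (min_le_left _ _).trans_lt (by norm_num)
  have hθδ' : θ ≤ 1 - δ' := by have := min_le_right (1 / 2 : ℝ) (1 - θ); linarith
  obtain ⟨w, hw0, hw⟩ := exists_exp_neg_lt (δ * δ' / (1 - δ')) (by
    have : 0 < 1 - δ' := by linarith
    positivity)
  refine ⟨δ', w, hδ'0, hδ'1, hw0, fun n => ⟨?_, ?_⟩⟩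
  · rw [productBoxes_quenched_allBad n δ' w]
    have hp0 : 0 ≤ (1 - δ') * exp (-w) / ((1 - δ') * exp (-w) + δ') := by
      have : 0 ≤ (1 - δ') * exp (-w) := mul_nonneg (by linarith) (exp_pos _).le
      positivity
    refine pow_le_pow_left₀ hp0 ?_ n
    refine (twoPoint_quenched_bad_le δ' w hδ'0 hδ'1.le).trans ?_
    have h1 : 0 < 1 - δ' := by linarith
    rw [div_le_iff₀ hδ'0]
    calc (1 - δ') * exp (-w) ≤ (1 - δ') * (δ * δ' / (1 - δ')) := mul_le_mul_of_nonneg_left hw.le h1.le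
      _ = δ * δ' := by field_simp
  · rw [productBoxes_ref_allBad]
    exact pow_le_pow_left₀ hθ0 hθδ' n

end Summit.QuantumFields.QCD.Theorems.SeaFactorisationBridge.Negative
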